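import Literature.Dynamics.TopologicalDynamics.ToralExpandingMapsShiftFactorHaar
import Literature.AlgebraicGeometry.HodgeTheory.AbelianVarietyExpandingEndomorphismsShiftFactor
import Literature.AlgebraicGeometry.HodgeTheory.AbelianVarietyErgodicEndomorphisms
import HarnessLib

/-!
# Expanding endomorphisms of complex abelian varieties are measure-theoretic factors of uniform Bernoulli shifts

Lane `lit-hodgefound` (HODGE PATH, Track 2 foundations library; prover seat `lit-hodgefound-p31`, row g25-#4, FILE 2),
in the lineage «dynamics of endomorphisms of abelian varieties».  The lane-side reading of
`Literature/Dynamics/TopologicalDynamics/ToralExpandingMapsShiftFactorHaar.lean` (FILE 1 of the row: the radix coding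
carries the uniform Bernoulli measure to Haar measure — Walters' «ψ preserves measure», §2.2 Example (2), for every
expanding `T_M`), read on a complex torus `X = E/Φ(ℤ^ι)` and on a complex abelian variety through a uniformisation
`φ : X ≃ A(ℂ)` (✔ `complexAbelianVariety_torusUniformised`), for the Haar probability measure `μ` of `A(ℂ)` (the
translation-invariant Borel probability measure; `μ = φ_* vol`, ✔ `eq_map_volume_of_map_mul_right_eq`).

## Main statements (theorems only; no definition, no named fact)

* `ComplexTorus.exists_measurePreserving_semiconj_fin_mapMatrix` — an expanding `ρ(M)` on a complex torus is a factor
  of the uniform Bernoulli shift on `|det M|` symbols by a continuous surjective MEASURE-PRESERVING semiconjugacy.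
* **`AbelianVariety.exists_measurePreserving_semiconj_of_expanding`** — for an endomorphism `f` of a complex abelian
  variety all of whose eigenvalues on `H¹(A(ℂ); ℚ)` have modulus `> 1`: there is a continuous surjection
  `Ψ : {0, …, deg f − 1}^ℕ → A(ℂ)` with `Ψ ∘ σ = f(ℂ) ∘ Ψ` carrying the uniform Bernoulli measure to the Haar
  probability measure `μ` — `(σ, β) → (A(ℂ), f(ℂ), μ)` is a measure-preserving factor map (Walters' Example (2),
  `x ↦ 2x` on `ℝ/ℤ`, for abelian varieties).

## References

* [Walters1982] P. Walters, *An Introduction to Ergodic Theory*, GTM 79 (1982), §2.2 Example (2) p. 70 (held text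
  chunk p0070); §0.6 Theorem 0.13 (uniqueness of the Haar probability measure).
* [BrinStuck2002] M. Brin, G. Stuck, *Introduction to Dynamical Systems*, CUP (2002), §1.3 (held text chunk p0013).
* [Lange2023AbelianVarietiesComplex] H. Lange, *Abelian Varieties over the Complex Numbers*, Springer (2023), §1.1.2
  Prop. 1.1.6, §1.1.3 Prop. 1.1.13 (c) (PDF pp. 19, 22).
-/

noncomputable section

open Set Function Filter Topology MeasureTheory
open CategoryTheory
open Literature.Dynamics.TopologicalDynamics
open Literature.Dynamics.Ergodic
open Literature.AlgebraicTopology.SingularHomology Literature.NumberTheory.LFunctions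
open Literature.NumberTheory.Transcendental (IsAnalytification)
open Literature.AlgebraicGeometry.Motives (ComplexPoints AbelianVariety AlgPoints specOver)
open scoped NNReal ENNReal Matrix

/-! ### §1 On a complex torus -/

namespace Literature.Geometry.Kaehler.ComplexTorus

variable {ι : Type*} [Fintype ι] [DecidableEq ι] {E : Type*} [NormedAddCommGroup E] [NormedSpace ℂ E]
  (Φ : (ι → ℝ) ≃L[ℝ] E)

/-- **An expanding endomorphism `ρ(M)` of a complex torus is a measure-theoretic factor of the uniform Bernoulli shift
on `|det M|` symbols**: there is `Ψ : {0, …, |det M| − 1}^ℕ → X` continuous, onto, with `Ψ ∘ σ = ρ(M) ∘ Ψ` and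
`Ψ_* (ν^{⊗ℕ}) = vol_X` for the uniform probability `ν`.
[cite: Walters1982, §2.2 Example (2) p. 70 (held text chunk p0070)] [cite: BrinStuck2002, §1.3 (held text chunk p0013)] -/
theorem exists_measurePreserving_semiconj_fin_mapMatrix (M : Matrix ι ι ℤ)
    (hexp : ∀ α ∈ (M.map (Int.castRingHom ℂ)).charpoly.roots, 1 < ‖α‖)
    (ν : Measure (Fin M.det.natAbs)) [IsProbabilityMeasure ν] (hν : ∀ a, ν {a} = ((M.det.natAbs : ℝ≥0∞))⁻¹) :
    ∃ Ψ : (ℕ → Fin M.det.natAbs) → ComplexTorus Φ, Continuous Ψ ∧ Surjective Ψ ∧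
      Semiconj Ψ (fun (s : ℕ → Fin M.det.natAbs) (n : ℕ) ↦ s (n + 1)) (mapMatrix Φ Φ M) ∧
      MeasurePreserving Ψ (Measure.infinitePi fun _ : ℕ ↦ ν) volume := by
  obtain ⟨Ψ, hc, hs, hsemi, hmp⟩ := ToralExpandingShiftFactorHaar.exists_measurePreserving_semiconj_fin M
    (T := fun x i ↦ ∑ j, M i j • x j) (fun _ _ ↦ rfl) hexp ν hν
  exact ⟨fun s ↦ (ComplexTorus.toRealTorus Φ).symm (Ψ s), (ComplexTorus.toRealTorus Φ).symm.continuous.comp hc,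
    (ComplexTorus.toRealTorus Φ).symm.surjective.comp hs, fun s ↦ congrArg (ComplexTorus.toRealTorus Φ).symm (hsemi s),
    hmp⟩

end Literature.Geometry.Kaehler.ComplexTorus

/-! ### §2 On a complex abelian variety -/

namespace Literature.AlgebraicGeometry.HodgeTheory

open Literature.Geometry.Kaehler

section BernoulliFactor

variable (A : AbelianVariety ℂ) (f : A ⟶ A) [MeasurableSpace (ComplexPoints A.X)] [BorelSpace (ComplexPoints A.X)]
  (μ : Measure (ComplexPoints A.X)) [IsProbabilityMeasure μ]
  (hμ : ∀ Q : A.Points ℂ, Measure.map (fun P : A.Points ℂ ↦ P * Q) μ = μ)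

include hμ in
/-- **Through a uniformisation:** if a group uniformisation `φ : E/Φ(ℤ^ι) ≃ A(ℂ)` conjugates `f(ℂ)` to `ρ(M)` with
every eigenvalue of `M` of modulus `> 1`, then for the uniform probability `ν` on `{0, …, |det M| − 1}` there is a
continuous surjection `Ψ : {0, …, |det M| − 1}^ℕ → A(ℂ)` with `Ψ ∘ σ = f(ℂ) ∘ Ψ` and `Ψ_* (ν^{⊗ℕ}) = μ`, the Haar
probability measure of `A(ℂ)`.
[cite: Walters1982, §2.2 Example (2) p. 70 and §0.6 Theorem 0.13 (held text chunks p0070, p0022)]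
[cite: Lange2023AbelianVarietiesComplex, §1.1.2 Prop. 1.1.6 (PDF p. 19)] -/
theorem AbelianVariety.exists_measurePreserving_semiconj_of_semiconj {ι : Type} [Fintype ι] [DecidableEq ι]
    {E : Type} [NormedAddCommGroup E] [NormedSpace ℂ E] [FiniteDimensional ℂ E] {Φ : (ι → ℝ) ≃L[ℝ] E}
    {φ : ComplexTorus Φ → ComplexPoints A.X} (hφ : IsAnalytification E A.X A.dim φ)
    (hadd : ∀ x y, φ (x + y) = φ x * φ y) (M : Matrix ι ι ℤ)
    (hM : ∀ t, φ (ComplexTorus.mapMatrix Φ Φ M t) = AlgPoints.mapContinuous (L := ℂ) f.hom.hom.hom (φ t))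
    (hexp : ∀ α ∈ (M.map (Int.castRingHom ℂ)).charpoly.roots, 1 < ‖α‖)
    (ν : Measure (Fin M.det.natAbs)) [IsProbabilityMeasure ν] (hν : ∀ a, ν {a} = ((M.det.natAbs : ℝ≥0∞))⁻¹) :
    ∃ Ψ : (ℕ → Fin M.det.natAbs) → A.Points ℂ, Continuous Ψ ∧ Surjective Ψ ∧
      Semiconj Ψ (fun (s : ℕ → Fin M.det.natAbs) (n : ℕ) ↦ s (n + 1)) (AlgPoints.mapContinuous (L := ℂ) f.hom.hom.hom) ∧
      MeasurePreserving Ψ (Measure.infinitePi fun _ : ℕ ↦ ν) μ := by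
  obtain ⟨Ψ₀, hc, hs, hsemi, hmp⟩ := ComplexTorus.exists_measurePreserving_semiconj_fin_mapMatrix Φ M hexp ν hν
  have hμφ := eq_map_volume_of_map_mul_right_eq A hφ hadd μ hμ
  have hφm : MeasurePreserving φ (volume : Measure (ComplexTorus Φ)) μ :=
    ⟨hφ.isHomeomorph.continuous.measurable, hμφ.symm⟩
  exact ⟨fun s ↦ φ (Ψ₀ s), hφ.isHomeomorph.continuous.comp hc, hφ.isHomeomorph.surjective.comp hs,
    fun s ↦ by simp only [hsemi s, hM], hφm.comp hmp⟩

include hμ in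
/-- **An expanding isogeny of a complex abelian variety is a measure-theoretic factor of the uniform Bernoulli shift
on `deg f` symbols.**  Let `f : A → A` be an endomorphism every eigenvalue of whose action on `H¹(A(ℂ); ℚ)` has
modulus `> 1` (so `f` is an isogeny, `deg f = #Ker f(ℂ)`), `μ` the Haar probability measure of `A(ℂ)` and `ν` the
uniform probability on `{0, …, deg f − 1}`.  Then there is a continuous surjection `Ψ : {0, …, deg f − 1}^ℕ → A(ℂ)`
with `Ψ ∘ σ = f(ℂ) ∘ Ψ` AND `Ψ_* (ν^{⊗ℕ}) = μ`: the radix coding of ✔ `AbelianVariety.exists_isFactor_shift_of_expanding`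
is measure preserving — Walters' Example (2) («`ψ` is onto and `ψT₂ = Sψ`. Also `ψ` preserves measure») for
abelian varieties.
[cite: Walters1982, §2.2 Example (2) p. 70 (held text chunk p0070)]
[cite: BrinStuck2002, §1.3 (held text chunk p0013)]
[cite: Lange2023AbelianVarietiesComplex, §1.1.2 Prop. 1.1.6, §1.1.3 Prop. 1.1.13 (c) (PDF pp. 19, 22)] -/
theorem AbelianVariety.exists_measurePreserving_semiconj_of_expanding
    (h : ∀ α ∈ FrobeniusCharpoly.eigenvalues ℂ
      (singularCohomology.map ℚ ℚ (AlgPoints.mapContinuous (L := ℂ) f.hom.hom.hom) 1).hom, 1 < ‖α‖) :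
    ∀ (ν : Measure (Fin (Nat.card (AbelianVariety.Hom.kerPoints (specOver ℂ ℂ) f)))), IsProbabilityMeasure ν →
      (∀ a, ν {a} = ((Nat.card (AbelianVariety.Hom.kerPoints (specOver ℂ ℂ) f) : ℝ≥0∞))⁻¹) →
      ∃ Ψ : (ℕ → Fin (Nat.card (AbelianVariety.Hom.kerPoints (specOver ℂ ℂ) f))) → A.Points ℂ,
        Continuous Ψ ∧ Surjective Ψ ∧
        Semiconj Ψ (fun (s : ℕ → Fin (Nat.card (AbelianVariety.Hom.kerPoints (specOver ℂ ℂ) f))) (n : ℕ) ↦ s (n + 1))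
          (AlgPoints.mapContinuous (L := ℂ) f.hom.hom.hom) ∧
        MeasurePreserving Ψ (Measure.infinitePi fun _ : ℕ ↦ ν) μ := by
  obtain ⟨ι, _, _, Φ, φ, hφ, hadd⟩ := complexAbelianVariety_torusUniformised_holds A
  obtain ⟨M, hM⟩ := exists_mapMatrix_comp_eq_of_hom Φ Φ ⟨φ, hφ.isHomeomorph.continuous⟩ hφ hadd
    ⟨φ, hφ.isHomeomorph.continuous⟩ hφ hadd f
  have hM' : ∀ t, φ (ComplexTorus.mapMatrix Φ Φ M t) = AlgPoints.mapContinuous (L := ℂ) f.hom.hom.hom (φ t) :=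
    fun t ↦ hM t
  rw [eigenvalues_singularCohomology_map_one_eq_roots_charpoly A f hφ hM'] at h
  have hcard : Nat.card (AbelianVariety.Hom.kerPoints (specOver ℂ ℂ) f) = M.det.natAbs := by
    rw [AbelianVariety.natCard_kerPoints_eq_natAbs_det_of_end f,
      det_singularHomology_map_one Φ A ⟨φ, hφ.isHomeomorph.continuous⟩ hφ
        (AlgPoints.mapContinuous (L := ℂ) f.hom.hom.hom) M hM]
  rw [hcard]
  intro ν _ hν
  exact AbelianVariety.exists_measurePreserving_semiconj_of_semiconj A f μ hμ hφ hadd M hM' h ν hν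

end BernoulliFactor

end Literature.AlgebraicGeometry.HodgeTheory
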